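import Summits.BirchSwinnertonDyer.BirchSwinnertonDyer.Theses.PrintX10b
import Summits.BirchSwinnertonDyer.BirchSwinnertonDyer.Theorems.PrintX8VerticalStevensIrreducible
import HarnessLib

/-!
# LINE `theoremB-x10b` (crux `PrintX10b.AnalyticMuZeroX10b`, stmt-BirchSwinnertonDyer-20682) — STUB 2 CLOSED BY NAME

`stub_nonconstancy_of_theoremB` (registered skeleton v4, sha16 41c1930e4741df0b, cell bsd-f3-mu -imc g7) with its
EXACT registered signature, proved by the tree theorem
`PrintX8VerticalStevens.cycWindingNonConstancyOddIrreducible_of_conjSpanGenAll` (bsd-print-x8 p1 g4, p569759):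
THEOREM B (`∀ N p, p.Prime → ¬ p ∣ N → ConjSpanGen N p`) ⟹ AN-9 non-constancy of the cyclotomic winding function
mod `p` for every odd good prime `p` with `E[p]` irreducible.  No named fact.  (A second, independent kernel proof:
bsd-f3-mu -an g5 `AN9.lean` v2 2accc625eee21839.)
[cite: MazurTateTeitelbaum1986Invent, §I.10 (10.1)] [cite: Stevens1982, §1.1]
-/

namespace Summit.BirchSwinnertonDyer.BirchSwinnertonDyer.Cruxes.AnalyticMuZeroX10b.TheoremB

open WeierstrassCurve Literature.NumberTheory.EllipticCurves Literature.NumberTheory.EllipticCurves.Rank1Residual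

/-- **Stub 2 of LINE theoremB-x10b, by name and registered signature**: THEOREM B ⟹ AN-9.
[cite: MazurTateTeitelbaum1986Invent, §I.10 (10.1)] -/
theorem stub_nonconstancy_of_theoremB :
    (∀ (N p : ℕ), p.Prime → ¬ p ∣ N → ConjSpanGen N p) →
      ∀ (W : WeierstrassCurve ℚ) [W.IsElliptic] [W.IsGloballyMinimal] (p : ℕ) [Fact p.Prime],
        p ≠ 2 → W.HasGoodReductionAtPrime p → W.HasIrreducibleModPGaloisRep p → CycWindingNonConstantAt W p :=
  fun hB =>
    Summit.BirchSwinnertonDyer.BirchSwinnertonDyer.Theorems.PrintX8VerticalStevens.cycWindingNonConstancyOddIrreducible_of_conjSpanGenAll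
      (fun M q _ hq hqM => hB M q hq hqM)

end Summit.BirchSwinnertonDyer.BirchSwinnertonDyer.Cruxes.AnalyticMuZeroX10b.TheoremB
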